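import Literature.AnabelianGeometry.EtaleTheta.ArithThetaTowerHullConstants
import HarnessLib

/-!
# [IUTchI] Ex. 3.2 (iv) at the ARITHMETIC theta tower, part 2: `𝒞⊢_v → 𝒞_v = ℱ̲_v^{bs-fld}` FAITHFUL over
# `𝒟⊢_v ⊆ 𝒟_v` — sub-gap (a) of GAP A, produced from the decoupling spec `CarrierSpec` (item GA-13, file 2/2)

S. Mochizuki, *Inter-universal Teichmüller Theory I* [Mochizuki2012], Ex. 3.2 (iv) p.71: «the resulting submonoid
`Φ_{𝒞⊢_v} := ℕ·log_Φ(q̲_v)|_{𝒟⊢_v} ⊆ Φ_{𝒞_v}|_{𝒟⊢_v}` … determines a `p_v`-adic Frobenioid with base category given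
by `𝒟⊢_v` [cf. [FrdII], Example 1.1, (ii)] `𝒞⊢_v (⊆ 𝒞_v ⊆ ℱ̲_v)`» [claim: Mochizuki2012, status: disputed] (D-0012
claim key; DEFINITIONS only, nothing of the series asserted); *The étale theta function …* [MochizukiEtTh2009]
Def. 3.6 (iv) p.78 (the base-field-theoretic hull `𝒞^{bs-fld}` = the model Frobenioid of
`(𝒟, Φ^{bs-fld}, F, F → (Φ^{bs-fld})^gp)`); *The geometry of Frobenioids I* [MochizukiFrdI2008] Thm. 5.2 (i) p.100
(the model Frobenioid), Thm. 6.2 (i) p.111 («it follows formally from the definition of the category underlying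
a model Frobenioid … that we obtain a functor» from compatible `Φ₁ → Φ₂|_{D₁}`, `B₁ → B₂|_{D₁}` — the tree's
`ModelFrobenioid.DataHomOver.functor`), Prop. 4.4 (ii) p.83 (`toBirat` faithful, binder `hsq`).

GAP A of record G-L5-EX32I-1 (abc-iut cell), item GA-13 = sub-gap (a) PROPER of row D6 of GAP-SIZING-A.md
69de97346848d3e8 (GAP-LEDGER l.937: «`CdashToC : d.Cdash hq ⥤ C.hullCategory` FAITHFUL over 𝒟⊢_v̲ ⊆ 𝒟_v̲ is
UNSATISFIABLE at every tower/skeleton model of record … carrier wanted = … the identification Ω^U ↔ K_U^×»);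
ruled shape `plan/L5/GAP-A-SIGNATURES.md` v1 e3ccddf9b87597cf §0/§5 (RULINGS #331 «every D6 decl is stated over the
BINDERS `(C) (hC : CarrierSpec d T C)`, never over the term»; #341 (B) «GA-13 supplies `(CdashToC, h₁, h₂)` of
`ThetaRestBiratData.toRestBirat` non-vacuously»); acceptance crit-A F2 (CO-SIGNED #332 (3)): constants via
`T.proj`/`fixedFld` (NOT via `rebase`), faithful NON-VACUOUSLY over all of `𝒟⊢ ⊆ 𝒟`, `toBirat` BY NAME with `hsq`.

WHAT IS HERE (over the §0 binders and `{T'} {VD} {C} (hC : CarrierSpec d T C) {qroot} (hq : ¬ IsUnit qroot)`; the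
hull `C.hullCategory` and `d.Cdash hq` do not depend on `hF`, which is therefore a binder only of §4/§5; FILE 1/2
`ArithThetaTowerHullConstants.lean` carries the object-level maps `CarrierSpec.constDivBsFld` / `constCnstFn` — genuine
valuations / constants as base-field-theoretic divisors / constant functions of the hull at EVERY object via
`T.proj ⋙ d.fieldFunctor` — and the `𝒟⊢_v̲ ⊆ 𝒟_v̲` plumbing `logqOrd`, `counitFieldHom`, `cdashExp`, `Cdash.*_eq_*`):
* §2 the morphism of model data OVER `T.incl : 𝒟⊢_v̲ ⥤ 𝒟_v̲` ([FrdI] Thm. 6.2 (i) shape `ModelFrobenioid.DataHomOver`)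
  from the data `(ℕ·log_Φ(q̲_v̲), B^c)` of the REAL `GaloisValDatum.Cdash hq` to the hull data
  `(Φ^{bs-fld}, F^{bs})` restricted to `𝒟⊢_v̲`: `n·log_Φ(q̲) ↦ n·ι(ord q̲)` (`CarrierSpec.cdashDiv`), a rational function
  `x ∈ (Ω^V)^×` with `ord x ∈ ℤ·ord q̲` `↦` the constant function `κ x` (`CarrierSpec.cdashUnit`, along the counit
  `T.proj (T.incl V) ⟶ V` of `T.adj`, an isomorphism of `𝒟⊢_v̲`), compatibility with `Div` PROVED
  (`CarrierSpec.cdashHullHom`); **`cdashToC hC hq : d.Cdash hq ⥤ C.hullCategory`** := its induced functor.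
* §3 **`cdashToC_faithful`** — PROVED for EVERY `hC` (no hypothesis on the abstract realified data `T'`):
  `T.incl` faithful, `κ` injective (`hC.constEmb_injective`), field maps injective, and the remaining components
  pinned by relation (d) of [FrdI] Thm. 5.2 (i) and the fibre-product condition of `B^c` (integrality of
  `ord(𝒪^▷) ⊗ ℝ_{≥0}`).  **`cdashToC_base`** — over `𝒟⊢_v̲ ⊆ 𝒟_v̲` ON THE NOSE (`cdashToC ⋙ hull ⋙ base = CdashBase ⋙ T.incl`).
* §4 `hasBiratSquares hF` — the `hsq` binder of [FrdI] Prop. 4.4 `PreFrobenioid.toBirat_faithful` AT `C`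
  (`hasBiratSquares_of_isFrobenioid`), and `toBirat_faithful_of_isFrobenioid`; §5 `ThetaRestBiratData.toRestBiratOfCarrierSpec` —
  GA-06's assembler `toRestBirat (X) (CdashToC) (h₁) (h₂) (h₃) (h₄)` with `(CdashToC, h₁, h₂)` := this file's triple
  (GA-16 supplies `h₃`, `h₄` and passes `(l : ℕ)` to `thetaRestBiratData`).
NON-VACUITY: the functor is defined on ALL of `𝒞⊢_v̲` (every object `V` of `𝒟⊢_v̲`, every morphism) and is faithful
by proof for every carrier satisfying the spec; the spec is inhabited by GA-12's term (`carrierSpec_temperedFrobenioid`,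
not imported here: binders, never the term).  Why (a) is honest here and not at the tower models of record: the
hull's constant functions at `T.incl V` CONTAIN `(Ω^V)^×` with its genuine valuation (`hC.consts`), so the
`(Ω^V)^×`-torsors of Hom-sets of `𝒞⊢_v̲` embed.
carrier: genuine-by-[EtTh]-recipe on the T-lattice (Ÿ_T, Ÿ_T × V, X̲̲_v̲ × V) + constants everywhere; off-lattice Φ via
`rebase`/pullback; [EtTh] Def 3.3 Φ at general U and print's Ÿ̈/μ_N Kummer levels = FOUNDATIONS 13/14, not claimed
(#322 (c3′); this file defines no carrier, it reads the one `hC` specifies).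
HONEST FRAMING: a functor and two laws over a `Prop`-valued spec at OUR typed objects; TYPED ≠ INHABITED (the term is
GA-12's) ≠ proved-in-print; an UNDISPUTED construction around [IUTchIII] Cor. 3.12, which stays OPEN by charter
(D-0045) — no side taken on it or on any author; nothing here asserts the abc conjecture proved or refuted;
count-neutral.  No instance, no notation, no `sorry`.
-/

noncomputable section

namespace Literature.AnabelianGeometry.EtaleTheta

namespace ArithThetaTower

open CategoryTheory Opposite Function Literature.AlgebraicGeometry.Frobenioids Literature.AnabelianGeometry.SemiGraphs
  Literature.IUT.HodgeTheaters Literature.AlgebraicGeometry.Frobenioids.PadicFrd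

variable {p : ℕ} [Fact p.Prime] (d : GaloisValDatum.{0} p) {P : Type} [Group P] [TopologicalSpace P]
  (T : BadLocalGroupDatum d.Gal P)

variable {d T} {T' : RealifiedDivisorMonoids (D₀ := T.Dv) treeMonoidVocabWeak.{0}} {VD : FrdICatStub.{0, 0, 0} T.Dv}
  {C : TemperedFrobenioid T' T.Dv VD}
namespace CarrierSpec

variable {qroot : intNonzero d.k}

/-- **`Φ_{𝒞⊢_v}(V) → Φ^{bs-fld}(T.incl V)`, `n·log_Φ(q̲_v) ↦ n·ι(ord q̲_v)`** — «`ℕ·log_Φ(q̲_v)|_{𝒟⊢_v} ⊆ Φ_{𝒞_v}|_{𝒟⊢_v}`»: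
the divisor-monoid component of `𝒞⊢_v → 𝒞_v` at `V`. ([IUTchI] Ex 3.2 (iv) p.71) [claim: Mochizuki2012, status: disputed] -/
def cdashDiv (hC : CarrierSpec d T C) (hq : ¬ IsUnit qroot) (A : (CosetCat d.Gal)ᵒᵖ) :
    Submonoid.powers (Monogenic.gen d.fieldFunctor (d.relEmb.img qroot) A.unop) →*
      C.bsFld.carrier (op (T.incl.obj A.unop)) :=
  (hC.constDivBsFld (T.incl.obj A.unop)).comp (cdashExp T hq A)

/-- `cdashDiv (n·log_Φ(q̲_v)) = n·ι(ord q̲_v)`. ([IUTchI] Ex 3.2 (iv) p.71) [claim: Mochizuki2012, status: disputed] -/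
theorem cdashDiv_pow (hC : CarrierSpec d T C) (hq : ¬ IsUnit qroot) (A : (CosetCat d.Gal)ᵒᵖ) (n : ℕ) :
    hC.cdashDiv hq A ⟨Monogenic.gen d.fieldFunctor (d.relEmb.img qroot) A.unop ^ n, n, rfl⟩ =
      hC.constDivBsFld (T.incl.obj A.unop) (logqOrd T qroot (T.incl.obj A.unop)) ^ n := by
  rw [cdashDiv, MonoidHom.comp_apply, cdashExp_pow, map_pow]

/-- **`cdashDiv` is natural** (`ord(q̲_v)` is a constant section and `ι` is natural).
([IUTchI] Ex 3.2 (iv) p.71) [claim: Mochizuki2012, status: disputed] -/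
theorem cdashDiv_natural (hC : CarrierSpec d T C) (hq : ¬ IsUnit qroot) {A B : (CosetCat d.Gal)ᵒᵖ} (f : A ⟶ B)
    (z : Submonoid.powers (Monogenic.gen d.fieldFunctor (d.relEmb.img qroot) A.unop)) :
    hC.cdashDiv hq B (Monogenic.ΦMap d.fieldFunctor (d.relEmb.isConstantSection hq) f z) =
      C.bsFld.pull (T.incl.map f.unop).op (hC.cdashDiv hq A z) := by
  obtain ⟨_, n, rfl⟩ := z
  have h1 : Monogenic.ΦMap d.fieldFunctor (d.relEmb.isConstantSection hq) f
      ⟨Monogenic.gen d.fieldFunctor (d.relEmb.img qroot) A.unop ^ n, n, rfl⟩ =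
        ⟨Monogenic.gen d.fieldFunctor (d.relEmb.img qroot) B.unop ^ n, n, rfl⟩ :=
    Subtype.ext (by rw [Monogenic.coe_ΦMap, map_pow, Monogenic.phi0Map_gen d.fieldFunctor (d.relEmb.isConstantSection hq)])
  rw [h1, cdashDiv_pow, cdashDiv_pow, map_pow, hC.pull_constDivBsFld, ordIntMapOfHom_logqOrd hq]

/-- **`Φ_{𝒞⊢_v} → Φ^{bs-fld}|_{𝒟⊢_v}` as a homomorphism of monoids on `𝒟⊢_v̲`**. ([IUTchI] Ex 3.2 (iv) p.71)
[claim: Mochizuki2012, status: disputed] -/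
def cdashDivNatTrans (hC : CarrierSpec d T C) (hq : ¬ IsUnit qroot) : (d.dashDatum hq).Φ ⟶ T.incl.op ⋙ C.bsFldMonoid where
  app A := CommMonCat.ofHom (hC.cdashDiv hq A)
  naturality {A B} f := by
    apply CommMonCat.hom_ext
    refine MonoidHom.ext fun z => ?_
    change hC.cdashDiv hq B (Monogenic.ΦMap d.fieldFunctor (d.relEmb.isConstantSection hq) f z) =
      C.bsFld.pull (T.incl.map f.unop).op (hC.cdashDiv hq A z)
    exact hC.cdashDiv_natural hq f z

/-- **`B_{𝒞⊢_v}(V) → F^{bs}(T.incl V)`**: a rational function of `𝒞⊢_v̲` at `V` — a unit `x ∈ (Ω^V)^×` with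
`ord x ∈ ℤ·ord q̲_v` — `↦` the genuine constant function `κ x` of the hull (read in the base field of `T.incl V` along
`counitFieldHom`).  The unit component of `𝒞⊢_v → 𝒞_v` at `V`. ([IUTchI] Ex 3.2 (iv) p.71) [claim: Mochizuki2012, status: disputed] -/
def cdashUnit (hC : CarrierSpec d T C) (hq : ¬ IsUnit qroot) (A : (CosetCat d.Gal)ᵒᵖ) :
    Monogenic.BSub d.fieldFunctor (d.relEmb.isConstantSection hq) A →* C.cnstFnBs (op (T.incl.obj A.unop)) :=
  (hC.constCnstFn (T.incl.obj A.unop)).comp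
    ((Units.map (counitFieldHom T A.unop : (d.fieldFunctor.obj A.unop).K →* _)).comp
      ((MonoidHom.fst _ _).comp (Monogenic.BSub d.fieldFunctor (d.relEmb.isConstantSection hq) A).subtype))

/-- The value of `cdashUnit`. ([IUTchI] Ex 3.2 (iv) p.71) [claim: Mochizuki2012, status: disputed] -/
theorem cdashUnit_apply (hC : CarrierSpec d T C) (hq : ¬ IsUnit qroot) (A : (CosetCat d.Gal)ᵒᵖ)
    (u : Monogenic.BSub d.fieldFunctor (d.relEmb.isConstantSection hq) A) :
    hC.cdashUnit hq A u = hC.constCnstFn (T.incl.obj A.unop)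
      (Units.map (counitFieldHom T A.unop : (d.fieldFunctor.obj A.unop).K →* _) u.1.1) := rfl

/-- **`cdashUnit` is natural** (naturality of `κ` and of the counit). ([IUTchI] Ex 3.2 (iv) p.71)
[claim: Mochizuki2012, status: disputed] -/
theorem cdashUnit_natural (hC : CarrierSpec d T C) (hq : ¬ IsUnit qroot) {A B : (CosetCat d.Gal)ᵒᵖ} (f : A ⟶ B)
    (u : Monogenic.BSub d.fieldFunctor (d.relEmb.isConstantSection hq) A) :
    hC.cdashUnit hq B (Monogenic.BMap d.fieldFunctor (d.relEmb.isConstantSection hq) f u) =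
      C.cnstFnBsPull (T.incl.map f.unop).op (hC.cdashUnit hq A u) := by
  have key : ((counitFieldHom T B.unop : (d.fieldFunctor.obj B.unop).K →* _).comp
      ((d.fieldFunctor.map f.unop).alg : (d.fieldFunctor.obj A.unop).K →* (d.fieldFunctor.obj B.unop).K)) =
        ((d.fieldFunctor.map (T.proj.map (T.incl.map f.unop))).alg :
          (d.fieldFunctor.obj (T.proj.obj (T.incl.obj A.unop))).K →* (d.fieldFunctor.obj (T.proj.obj (T.incl.obj B.unop))).K).comp
        (counitFieldHom T A.unop : (d.fieldFunctor.obj A.unop).K →* _) :=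
    MonoidHom.ext fun y => DFunLike.congr_fun (counitFieldHom_comp (T := T) f.unop) y
  calc hC.cdashUnit hq B (Monogenic.BMap d.fieldFunctor (d.relEmb.isConstantSection hq) f u)
      = hC.constCnstFn (T.incl.obj B.unop) (Units.map (counitFieldHom T B.unop : (d.fieldFunctor.obj B.unop).K →* _)
          (Units.map ((d.fieldFunctor.map f.unop).alg : (d.fieldFunctor.obj A.unop).K →* (d.fieldFunctor.obj B.unop).K)
            u.1.1)) := rfl
    _ = hC.constCnstFn (T.incl.obj B.unop) (Units.map ((d.fieldFunctor.map (T.proj.map (T.incl.map f.unop))).alg :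
          (d.fieldFunctor.obj (T.proj.obj (T.incl.obj A.unop))).K →* (d.fieldFunctor.obj (T.proj.obj (T.incl.obj B.unop))).K)
          (Units.map (counitFieldHom T A.unop : (d.fieldFunctor.obj A.unop).K →* _) u.1.1)) :=
        congrArg (hC.constCnstFn (T.incl.obj B.unop)) (DFunLike.congr_fun (congrArg Units.map key) u.1.1)
    _ = C.cnstFnBsPull (T.incl.map f.unop).op (hC.constCnstFn (T.incl.obj A.unop)
          (Units.map (counitFieldHom T A.unop : (d.fieldFunctor.obj A.unop).K →* _) u.1.1)) :=
        (hC.cnstFnBsPull_constCnstFn (T.incl.map f.unop) _).symm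
    _ = C.cnstFnBsPull (T.incl.map f.unop).op (hC.cdashUnit hq A u) := rfl

/-- **Compatibility with `Div`**: for a rational function `(x, γ)` of `𝒞⊢_v̲` at `V`, `cdashExp^gp (γ) = ord(σ x)` in
`ord(𝒪^▷_{Ω^{aug(T.incl V)}})^gp` — checked after the injective `ord(𝒪^▷) → ord(𝒪^▷) ⊗ ℝ_{≥0}` (monoprime value monoid of a
`p_v`-adic local field), where it is the fibre-product condition transported along the counit.
([IUTchI] Ex 3.2 (iv) p.71) [claim: Mochizuki2012, status: disputed] -/
theorem gpMap_cdashExp_eq (hq : ¬ IsUnit qroot) (A : (CosetCat d.Gal)ᵒᵖ)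
    (u : Monogenic.BSub d.fieldFunctor (d.relEmb.isConstantSection hq) A) :
    MonGp.map (cdashExp T hq A) u.1.2 =
      gpMapOfHom (counitFieldHom T A.unop) (counitFieldHom_isValHom (T := T) A.unop)
        (divUnits (d.fieldFunctor.obj A.unop).K u.1.1) := by
  haveI := isCancelMul_realification (OrdInt (d.fieldFunctor.obj (T.proj.obj (T.incl.obj A.unop))).K)
  have hinj := MonGp.map_injective (Realification.of (OrdInt (d.fieldFunctor.obj (T.proj.obj (T.incl.obj A.unop))).K))
    (Realification.of_injective ((d.dashDatum hq).isMonoprime_ordInt_fld (T.proj.obj (T.incl.obj A.unop))))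
  apply hinj
  have e1 : MonGp.map (Realification.of _) (MonGp.map (cdashExp T hq A) u.1.2) =
      MonGp.map (phi0Map d.fieldFunctor (inclCounit T A.unop).op)
        (MonGp.map (Submonoid.powers (Monogenic.gen d.fieldFunctor (d.relEmb.img qroot) A.unop)).subtype u.1.2) :=
    ((DFunLike.congr_fun (MonGp.map_comp (Realification.of _) (cdashExp T hq A)) u.1.2).symm.trans
      (DFunLike.congr_fun (congrArg MonGp.map (realificationOf_comp_cdashExp (T := T) hq A)) u.1.2)).trans
      (DFunLike.congr_fun (MonGp.map_comp (phi0Map d.fieldFunctor (inclCounit T A.unop).op)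
        (Submonoid.powers (Monogenic.gen d.fieldFunctor (d.relEmb.img qroot) A.unop)).subtype) u.1.2)
  have e2 : MonGp.map (Realification.of _) (gpMapOfHom (counitFieldHom T A.unop)
      (counitFieldHom_isValHom (T := T) A.unop) (divUnits (d.fieldFunctor.obj A.unop).K u.1.1)) =
        MonGp.map (Realification.map (ordIntMapOfHom (counitFieldHom T A.unop)
          (counitFieldHom_isValHom (T := T) A.unop))) (divZeroHom (d.fieldFunctor.obj A.unop).K u.1.1) :=
    DFunLike.congr_fun (realification_gp_square (counitFieldHom T A.unop)
      (counitFieldHom_isValHom (T := T) A.unop)) (divUnits (d.fieldFunctor.obj A.unop).K u.1.1)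
  have e3 : MonGp.map (phi0Map d.fieldFunctor (inclCounit T A.unop).op)
      (MonGp.map (Submonoid.powers (Monogenic.gen d.fieldFunctor (d.relEmb.img qroot) A.unop)).subtype u.1.2) =
        MonGp.map (Realification.map (ordIntMapOfHom (counitFieldHom T A.unop)
          (counitFieldHom_isValHom (T := T) A.unop))) (divZeroHom (d.fieldFunctor.obj A.unop).K u.1.1) := by
    rw [← divZeroHom_eq_of_mem_BSub hq A u, phi0Map_counit]
  exact e1.trans (e3.trans e2.symm)

/-- **Compatibility with `Div`, componentwise**: `cdashDiv^gp (Div_B (x, γ)) = Div_F (κ (σ x))`.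
([IUTchI] Ex 3.2 (iv) p.71) [claim: Mochizuki2012, status: disputed] -/
theorem cdash_comm (hC : CarrierSpec d T C) (hq : ¬ IsUnit qroot) (A : (CosetCat d.Gal)ᵒᵖ)
    (u : Monogenic.BSub d.fieldFunctor (d.relEmb.isConstantSection hq) A) :
    MonGp.map (hC.cdashDiv hq A) u.1.2 =
      gpMap (hC.constDivBsFld (T.incl.obj A.unop)) (divUnits _
        (Units.map (counitFieldHom T A.unop : (d.fieldFunctor.obj A.unop).K →* _) u.1.1)) := by
  have h := DFunLike.congr_fun (MonGp.map_comp (hC.constDivBsFld (T.incl.obj A.unop)) (cdashExp T hq A)) u.1.2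
  rw [divUnits_map _ (counitFieldHom_isValHom (T := T) A.unop), ← gpMap_cdashExp_eq hq A u]
  exact h

/-- **The morphism of model data `(Φ_{𝒞⊢_v}, B_{𝒞⊢_v}, Div) → (Φ^{bs-fld}, F^{bs}, Div)|_{𝒟⊢_v}` OVER `T.incl : 𝒟⊢_v̲ ⥤ 𝒟_v̲`**
([FrdI] Thm. 6.2 (i) shape): `η := cdashDivNatTrans`, `β :=` the `cdashUnit`s, compatibility with the divisor maps
PROVED (`cdash_comm`). ([IUTchI] Ex 3.2 (iv) p.71) [claim: Mochizuki2012, status: disputed] -/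
def cdashHullHom (hC : CarrierSpec d T C) (hq : ¬ IsUnit qroot) :
    ModelFrobenioid.DataHomOver T.incl (d.dashDatum hq).divB C.divFNatTrans where
  η := hC.cdashDivNatTrans hq
  β :=
    { app := fun A => CommMonCat.ofHom (hC.cdashUnit hq A)
      naturality := fun {A B} f => by
        apply CommMonCat.hom_ext
        refine MonoidHom.ext fun u => ?_
        change hC.cdashUnit hq B (Monogenic.BMap d.fieldFunctor (d.relEmb.isConstantSection hq) f u) =
          C.cnstFnBsPull (T.incl.map f.unop).op (hC.cdashUnit hq A u)
        exact hC.cdashUnit_natural hq f u }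
  comm A u := hC.cdash_comm hq A u

end CarrierSpec

/-- **`𝒞⊢_v → 𝒞_v = ℱ̲_v^{bs-fld}`** — the field `CdashToC : d.Cdash hq ⥤ C.hullCategory` of the slot structure
`TemperedThetaRestBirat` ([IUTchI] Ex. 3.2 (iv) «`𝒞⊢_v (⊆ 𝒞_v ⊆ ℱ̲_v)`», «`ℕ·log_Φ(q̲_v)|_{𝒟⊢_v} ⊆ Φ_{𝒞_v}|_{𝒟⊢_v}`»): the
functor of model Frobenioids induced ([FrdI] Thm. 5.2 (i)/6.2 (i), `ModelFrobenioid.DataHomOver.functor`) by the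
morphism of model data `cdashHullHom` over `T.incl : 𝒟⊢_v̲ ⥤ 𝒟_v̲` — on objects `(V, n·log_Φ(q̲_v)) ↦ (T.incl V, n·ι(ord q̲_v))`,
on morphisms `(deg, f, m·log_Φ(q̲_v), x) ↦ (deg, T.incl f, m·ι(ord q̲_v), κ x)`.  Defined on ALL of `𝒞⊢_v̲` from the GENUINE
constants of `hC.consts` (via `T.proj`/`fixedFld`, NOT via `rebase`; crit-A F2); sub-gap (a) of D-G-L5-EX32I-1.
([IUTchI] Ex 3.2 (iv) p.71) [claim: Mochizuki2012, status: disputed] -/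
def cdashToC (hC : CarrierSpec d T C) {qroot : intNonzero d.k} (hq : ¬ IsUnit qroot) : d.Cdash hq ⥤ C.hullCategory :=
  (hC.cdashHullHom hq).functor

/-! ## §3 Faithful, and over `𝒟⊢_v ⊆ 𝒟_v` -/

/-- `𝒞⊢_v → 𝒞_v` on objects. ([IUTchI] Ex 3.2 (iv) p.71) [claim: Mochizuki2012, status: disputed] -/
theorem cdashToC_obj (hC : CarrierSpec d T C) {qroot : intNonzero d.k} (hq : ¬ IsUnit qroot) (X : d.Cdash hq) :
    (cdashToC hC hq).obj X = ⟨T.incl.obj X.base, gpApp (hC.cdashDivNatTrans hq) (op X.base) X.cls⟩ := rfl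

/-- `𝒞⊢_v → 𝒞_v` preserves Frobenius degrees. ([IUTchI] Ex 3.2 (iv) p.71) [claim: Mochizuki2012, status: disputed] -/
theorem degFr_cdashToC_map (hC : CarrierSpec d T C) {qroot : intNonzero d.k} (hq : ¬ IsUnit qroot)
    {X Y : d.Cdash hq} (φ : X ⟶ Y) : ModelFrobenioid.degFr ((cdashToC hC hq).map φ) = ModelFrobenioid.degFr φ := rfl

/-- `𝒞⊢_v → 𝒞_v` lies over `T.incl` on base morphisms. ([IUTchI] Ex 3.2 (iv) p.71) [claim: Mochizuki2012, status: disputed] -/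
theorem baseMap_cdashToC_map (hC : CarrierSpec d T C) {qroot : intNonzero d.k} (hq : ¬ IsUnit qroot)
    {X Y : d.Cdash hq} (φ : X ⟶ Y) :
    ModelFrobenioid.baseMap ((cdashToC hC hq).map φ) = T.incl.map (ModelFrobenioid.baseMap φ) := rfl

/-- `𝒞⊢_v → 𝒞_v` on zero divisors: `m·log_Φ(q̲_v) ↦ m·ι(ord q̲_v)`. ([IUTchI] Ex 3.2 (iv) p.71) [claim: Mochizuki2012, status: disputed] -/
theorem div_cdashToC_map (hC : CarrierSpec d T C) {qroot : intNonzero d.k} (hq : ¬ IsUnit qroot)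
    {X Y : d.Cdash hq} (φ : X ⟶ Y) :
    ModelFrobenioid.div ((cdashToC hC hq).map φ) = hC.cdashDiv hq (op X.base) (ModelFrobenioid.div φ) := rfl

/-- The unit of the image of `φ` is the genuine constant function `κ(u_φ|_{K^×})`. ([IUTchI] Ex 3.2 (iv) p.71)
[claim: Mochizuki2012, status: disputed] -/
theorem unit_cdashToC_map (hC : CarrierSpec d T C) {qroot : intNonzero d.k} (hq : ¬ IsUnit qroot)
    {X Y : d.Cdash hq} (φ : X ⟶ Y) :
    ModelFrobenioid.unit ((cdashToC hC hq).map φ) =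
      hC.constCnstFn (T.incl.obj X.base) (Units.map (counitFieldHom T X.base : (d.fieldFunctor.obj X.base).K →* _)
        (ModelFrobenioid.unit φ).1.1) := rfl

/-- **`𝒞⊢_v → 𝒞_v → ℱ̲_v` sends the rational function of `φ` to GA-06's genuine constant-as-rational-function**
`constRatFn hC (T.incl V) (u_φ|_{K^×})`. ([IUTchI] Ex 3.2 (iv) p.71) [claim: Mochizuki2012, status: disputed] -/
theorem unit_hull_map_cdashToC_map (hC : CarrierSpec d T C) {qroot : intNonzero d.k} (hq : ¬ IsUnit qroot)
    {X Y : d.Cdash hq} (φ : X ⟶ Y) :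
    ModelFrobenioid.unit (C.hull.map ((cdashToC hC hq).map φ)) =
      constRatFn hC (T.incl.obj X.base) (Units.map (counitFieldHom T X.base : (d.fieldFunctor.obj X.base).K →* _)
        (ModelFrobenioid.unit φ).1.1) := by
  have h : ModelFrobenioid.unit (C.hull.map ((cdashToC hC hq).map φ)) =
      C.hullUnitM _ (ModelFrobenioid.unit ((cdashToC hC hq).map φ)) := rfl
  rw [h, unit_cdashToC_map]
  exact hC.hullUnitM_constCnstFn (T.incl.obj X.base) _

/-- **`𝒞⊢_v → 𝒞_v` is FAITHFUL** — the field `CdashToC_faithful` of `TemperedThetaRestBirat`, PROVED for every carrier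
satisfying the spec (sub-gap (a) of D-G-L5-EX32I-1, NON-VACUOUS over all of `𝒟⊢_v̲ ⊆ 𝒟_v̲`): `T.incl` is faithful,
`deg_Fr` is preserved, the `K^×`-component of the unit is recovered from `κ` (injective, `hC.constEmb_injective`) and the
injective field map `counitFieldHom`, its `Φ^gp`-component from the fibre-product condition (`ord(𝒪^▷) ⊗ ℝ_{≥0}`
integral), and the zero divisor from relation (d) of [FrdI] Thm. 5.2 (i).
([IUTchI] Ex 3.2 (iv) p.71) [claim: Mochizuki2012, status: disputed] -/
theorem cdashToC_faithful (hC : CarrierSpec d T C) {qroot : intNonzero d.k} (hq : ¬ IsUnit qroot) :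
    (cdashToC hC hq).Faithful := by
  haveI := T.incl_faithful
  refine ⟨fun {X Y} φ ψ h => ?_⟩
  have h1 : ModelFrobenioid.degFr φ = ModelFrobenioid.degFr ψ := by
    have h1' := congrArg ModelFrobenioid.degFr h
    exact h1'
  have h2 : ModelFrobenioid.baseMap φ = ModelFrobenioid.baseMap ψ := by
    have h2' := congrArg ModelFrobenioid.baseMap h
    exact T.incl.map_injective h2'
  have h4 := (unit_cdashToC_map hC hq φ).symm.trans ((congrArg ModelFrobenioid.unit h).trans (unit_cdashToC_map hC hq ψ))
  have hx := Units.map_injective (counitFieldHom_injective (T := T) X.base) (hC.constCnstFn_injective _ h4)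
  have hu := Cdash.unit_eq_of_fst_eq hq φ ψ hx
  exact ModelFrobenioid.hom_ext h1 h2 (Cdash.div_eq_of_eq hq φ ψ h1 h2 hu) hu

/-- `𝒞⊢_v → 𝒞_v → 𝒟_v` IS `𝒞⊢_v → 𝒟⊢_v ⊆ 𝒟_v` on the nose. ([IUTchI] Ex 3.2 (iv) p.71) [claim: Mochizuki2012, status: disputed] -/
theorem cdashToC_comp_hull_comp_base (hC : CarrierSpec d T C) {qroot : intNonzero d.k} (hq : ¬ IsUnit qroot) :
    cdashToC hC hq ⋙ C.hull ⋙ C.baseFunctorOfCategory = d.CdashBase hq ⋙ T.incl := rfl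

/-- **`𝒞⊢_v → 𝒞_v` lies over `𝒟⊢_v ⊆ 𝒟_v`** — the field `CdashToC_base` of `TemperedThetaRestBirat` (base maps agree:
`CdashBase` vs `CosetCat.pull` along `aug` = `T.incl`). ([IUTchI] Ex 3.2 (iv) p.71) [claim: Mochizuki2012, status: disputed] -/
theorem cdashToC_base (hC : CarrierSpec d T C) {qroot : intNonzero d.k} (hq : ¬ IsUnit qroot) :
    Nonempty (cdashToC hC hq ⋙ C.hull ⋙ C.baseFunctorOfCategory ≅ d.CdashBase hq ⋙ T.incl) :=
  ⟨eqToIso (cdashToC_comp_hull_comp_base hC hq)⟩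

/-! ## §4 The `hsq` binder of `toBirat_faithful` at `C` -/

/-- **`HasBiratSquares` AT `C`** — the `hsq` binder of [FrdI] Prop. 4.4 `PreFrobenioid.toBirat`/`toBirat_faithful`
(BirationalizationCategory.lean) at the tempered Frobenioid `C`, from `hF` ([FrdI] Prop. 1.11 (vii): co-angular squares
exist in a Frobenioid; the model-Frobenioid probe of record `hasBiratSquares_of_isFrobenioid`).  GA-06's `ℱ÷_v :=
PreFrobenioid.Birat C.toElem hF (hasBiratSquares_of_isFrobenioid hF)` reads this binder. [cite: MochizukiFrdI2008, Prop. 4.4 (ii) p.83] -/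
theorem hasBiratSquares (hF : PreFrobenioid.IsFrobenioid C.toElem) : PreFrobenioid.HasBiratSquares C.toElem :=
  PreFrobenioid.hasBiratSquares_of_isFrobenioid hF

/-- **`ℱ̲_v → ℱ÷_v := ℱ̲_v^birat` (`PreFrobenioid.toBirat` BY NAME) is faithful at `C`** with the `hsq` binder supplied.
[cite: MochizukiFrdI2008, Prop. 4.4 (ii) p.83] -/
theorem toBirat_faithful_of_isFrobenioid (hF : PreFrobenioid.IsFrobenioid C.toElem) :
    (PreFrobenioid.toBirat C.toElem hF (hasBiratSquares hF)).Faithful :=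
  PreFrobenioid.toBirat_faithful hF (hasBiratSquares hF)

/-! ## §5 Plugging `(CdashToC, h₁, h₂)` into GA-06's assembler -/

/-- **GA-06's assembler with this file's triple**: `TemperedThetaRestBirat d T hq C hF` from the data
`X : ThetaRestBiratData d T C hF hq`, `CdashToC := cdashToC hC hq`, `h₁ := cdashToC_faithful`, `h₂ := cdashToC_base`,
and GA-16's laws `h₃`, `h₄` for `X.CThetaToBirat` (RULINGS #341 (B): GA-16 passes `(l : ℕ)` to `thetaRestBiratData`).
([IUTchI] Ex 3.2 (ii) p.70) [claim: Mochizuki2012, status: disputed] -/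
def ThetaRestBiratData.toRestBiratOfCarrierSpec {hF : PreFrobenioid.IsFrobenioid C.toElem} {qroot : intNonzero d.k}
    {hq : ¬ IsUnit qroot} (X : ThetaRestBiratData d T C hF hq) (hC : CarrierSpec d T C)
    (h₃ : X.CThetaToBirat.Faithful)
    (h₄ : Nonempty (X.CThetaToBirat ⋙
      (PreFrobenioid.biratOps hF (PreFrobenioid.hasBiratSquares_of_isFrobenioid hF)).base ≅
        T.CThetaBase d hq ⋙ T.dThetaIncl ⋙ Over.forget T.ydd)) :
    TemperedThetaRestBirat d T hq C hF :=
  X.toRestBirat (cdashToC hC hq) (cdashToC_faithful hC hq) (cdashToC_base hC hq) h₃ h₄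

/-- Its `CdashToC` field IS `cdashToC hC hq`. ([IUTchI] Ex 3.2 (iv) p.71) [claim: Mochizuki2012, status: disputed] -/
theorem ThetaRestBiratData.toRestBiratOfCarrierSpec_CdashToC {hF : PreFrobenioid.IsFrobenioid C.toElem}
    {qroot : intNonzero d.k} {hq : ¬ IsUnit qroot} (X : ThetaRestBiratData d T C hF hq) (hC : CarrierSpec d T C)
    (h₃ : X.CThetaToBirat.Faithful)
    (h₄ : Nonempty (X.CThetaToBirat ⋙
      (PreFrobenioid.biratOps hF (PreFrobenioid.hasBiratSquares_of_isFrobenioid hF)).base ≅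
        T.CThetaBase d hq ⋙ T.dThetaIncl ⋙ Over.forget T.ydd)) :
    (X.toRestBiratOfCarrierSpec hC h₃ h₄).CdashToC = cdashToC hC hq := rfl

end ArithThetaTower

end Literature.AnabelianGeometry.EtaleTheta

end
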